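import Summits.ValiantsHypothesis.ValiantsHypothesis.Theorems.LacunarySymmetroidMatrixDescartesFiniteSectorTwoHubDesign
import Summits.ValiantsHypothesis.ValiantsHypothesis.Theorems.LacunarySymmetroidMatrixDescartesFiniteSectorTwoHubEstimates
import Summits.ValiantsHypothesis.ValiantsHypothesis.Theorems.LacunarySymmetroidMatrixDescartesFiniteSectorRealisable
import Summits.ValiantsHypothesis.ValiantsHypothesis.Theorems.LacunarySymmetroidMatrixDescartesFiniteSectorEtaTwoSix
import Summits.ValiantsHypothesis.ValiantsHypothesis.Theorems.LacunarySymmetroidMatrixDescartesFiniteSectorLadderCeiling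

/-!
# `MatrixDescartes` — line «finite» / «stamp»: THE `(0,1,4)` LADDER IS REALISABLE AT EVERY RUNG —
# `FullyRealisable m ![0,1,4] (4m − 6)` for EVERY `m ≥ 3`; hence `ν(m,3) ≥ 4m − 6` for all `m ≥ 3`, and the TOP of the `K = 3`
# stamp column at `m = 4, 5, 6` (`10, 14, 18 = n(m,2)`) from ONE all-`m` family

HONEST FRAMING.  Object-search cell `pub-symmetroid`, seat val-sym-eng-3 g11 (census/instrument ENGINE #3 of D-0148 (b)).
HELPER of the crux item `stmt-ValiantsHypothesis-18050`
(`Summit.ValiantsHypothesis.ValiantsHypothesis.Theses.LacunarySymmetroid.MatrixDescartes`, asymptotic in `K`) with NO closure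
claim.  Instrument/structure tier: an ALL-`m` REALISABILITY (lower-side) statement in the `K = 3` stamp column,

* `fullyRealisable_ladder014 (m) (hm : 3 ≤ m) : FullyRealisable m ![0, 1, 4] (4 * m - 6)` —

for every `m ≥ 3` a real symmetric half-pencil `S₀ + t S₁ + t⁴ S₂` whose determinant has degree exactly `4m − 6 = d(m+3−d) − 2`
(`d = 4`, the ceiling of the support: `natDegree_le_ladder` of `…FiniteSectorLadderCeiling`) and `4m − 6` distinct positive zeros.
For `m = 4, 5, 6` this IS the top of the column (`n(m,2) = 10, 14, 18`, `stampLawAt_K_three`; the tree's witnesses for these rows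
were found by numerical search — here they are instances of one design: `fullyRealisable_ladder014_top`); for `m ≥ 7` it is the rung
below the top.  Read as stamp-table rows: `ν(m,3) ≥ 4m − 6` (`not_stampLawAt_ladder014`; previous all-`m` kernel bound `3m − 2`,
`not_stampLawAt_ladder013`) and `η(m,3) ≥ 8m − 12` (`not_hypRootLawAt_ladder014`); with the ladder ceiling the `(0,1,4)` column is
EXACT for every `m ≥ 3` (`ladder014_exact`).  Nothing here bears on the crux (asymptotic in `K`) or on `VP ≠ VNP`.

THE WITNESS (`…FiniteSectorTwoHubDesign`, estimates `…FiniteSectorTwoHubEstimates`): `M = m − 2` quartic leaves and an affine node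
`h₁`, all hanging on the hub `h₂`, base `B = 16(M+1)`; `det = (∏ quartic leaf diagonals) · g`,
`g(t) = −(1 − t/(2B^{14M+9}))² + (t/B^{11} − 1) ∑_k H_k(t)`.  Along `u = log_B t`: before `u = 11` everything is non-positive (reading
`B⁹`: `−`); leaf `k` (0-based) then dominates and is read at `B^{14k+12}` (`+`), at its dip `B^{14k+13}` where `H_k = 0` and the hub
square speaks (`−`), at `B^{14k+15}` (`+`), and at the bridge `B^{14k+22}` after it has decayed (`−`); after the last leaf the hub's
own square dips to `0` at `t = 2B^{14M+9}` (`+`, the decayed last leaf speaks) and wins again at `B^{14M+24}` (`−`): `4M + 3 = 4m − 5`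
readings with the signs `(−1)^{i+1}` (`twoHub_sign_table`), strictly increasing and avoiding the zero `B^{11}` of the affine node
(`twoHub_points`), so `fullyRealisable_of_certificate` (…FiniteSectorRealisable) applies with the polynomial of `natDegree ≤ 4M + 2`.
Per leaf the design yields `d = 4` zeros = entry `1` + dip `2` + exit `1`; compared with the `(0,1,3)` arrow (`…LadderThree`) the extra
unit comes from the affine node, whose sign change at `B^{11}` shifts every later leaf and lets the hub square bridge consecutive leaves.
Exact cross-check `m = 4..8` (rational arithmetic, Sturm count `= 4m − 6`, dense sign scan at the predicted locations):
`HOME/val-sym-eng-3/g11/tools/hub2_chain.py`.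
[folklore] Intermediate value theorem bookkeeping; no citation is load-bearing.
-/

-- `Summit.ValiantsHypothesis.ValiantsHypothesis.…` repeats a component by the D-0017 layout
-- (single-conjunct summit), which the `dupNamespace` linter flags; the name is mandated.
set_option linter.dupNamespace false

namespace Summit.ValiantsHypothesis.ValiantsHypothesis.Theorems.LacunarySymmetroidMatrixDescartes.FiniteSector

open scoped BigOperators Matrix
open Polynomial Finset Matrix
open Summit.ValiantsHypothesis.ValiantsHypothesis.Theorems.SymmetroidDescartes (eval_det_pencil)
open Summit.ValiantsHypothesis.ValiantsHypothesis.Theorems.LacunarySymmetroidMatrixDescartes.WLawArrow (det_arrow)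

/-- The quartic leaf term (local notation, no definition). -/
local notation3 (prettyPrint := false) "H[" B ", " k "](" t ")" =>
  (((B : ℝ) / (B : ℝ) ^ (7 * (k : ℕ)) - (t : ℝ) / (B : ℝ) ^ (21 * (k : ℕ) + 12)) ^ 2
    / (1 + (t : ℝ) ^ 4 / (B : ℝ) ^ (56 * ((k : ℕ) + 1))))

/-- The Schur function `g` of the two-hub design (local notation, no definition). -/
local notation3 (prettyPrint := false) "gg[" B ", " M "](" t ")" =>
  (-(1 - (t : ℝ) / (2 * (B : ℝ) ^ (14 * (M : ℕ) + 9))) ^ 2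
    + ((t : ℝ) / (B : ℝ) ^ 11 - 1) * ∑ j : Fin (M : ℕ), H[B, j](t))

/-! ## §4 The certificate exponents `e_i` (`B⁹`; `B^{14k+12}, B^{14k+13}, B^{14k+15}, B^{14k+22}`; ·; `B^{14M+24}`) -/

/-- The exponent table is strictly increasing. [bookkeeping] -/
theorem twoHub_exp_mono (M i : ℕ) (hi : i + 1 ≤ 4 * M + 2) :
    (if i = 0 then 9 else if i = 4 * M + 2 then 14 * M + 24 else
      14 * ((i - 1) / 4) + (if (i - 1) % 4 = 0 then 12 else if (i - 1) % 4 = 1 then 13 else if (i - 1) % 4 = 2 then 15 else 22))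
    < (if (i + 1) = 0 then 9 else if (i + 1) = 4 * M + 2 then 14 * M + 24 else
      14 * ((i + 1 - 1) / 4) + (if (i + 1 - 1) % 4 = 0 then 12 else if (i + 1 - 1) % 4 = 1 then 13 else if (i + 1 - 1) % 4 = 2 then 15 else 22)) := by
  split_ifs <;> first | contradiction | omega

/-- No exponent of the table equals `11` (the zero of the affine node is never a reading point). [bookkeeping] -/
theorem twoHub_exp_ne (M i : ℕ) :
    (if i = 0 then 9 else if i = 4 * M + 2 then 14 * M + 24 else
      14 * ((i - 1) / 4) + (if (i - 1) % 4 = 0 then 12 else if (i - 1) % 4 = 1 then 13 else if (i - 1) % 4 = 2 then 15 else 22)) ≠ 11 := by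
  split_ifs <;> first | contradiction | omega

/-- The leaf readings: `e_{4q+c+1} = 14q + (12, 13, 15, 22)_c`. [bookkeeping] -/
theorem twoHub_exp_leaf (M q c : ℕ) (hc : c < 4) (hq : q < M) :
    (if (4 * q + c + 1) = 0 then 9 else if (4 * q + c + 1) = 4 * M + 2 then 14 * M + 24 else
      14 * ((4 * q + c + 1 - 1) / 4) + (if (4 * q + c + 1 - 1) % 4 = 0 then 12 else if (4 * q + c + 1 - 1) % 4 = 1 then 13 else if (4 * q + c + 1 - 1) % 4 = 2 then 15 else 22))
    = 14 * q + (if c = 0 then 12 else if c = 1 then 13 else if c = 2 then 15 else 22) := by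
  split_ifs <;> first | contradiction | omega



/-- **The sign table of the certificate** (on plain indices): with `τ_i` the `i`-th certificate point,
`(-1)^{i+1} g(τ_i) > 0` for every `i ≤ 4M + 2` (`M ≥ 1`, `B ≥ 8`, `4M < B`). [folklore] -/
theorem twoHub_sign_table {M : ℕ} (hM : 1 ≤ M) {B : ℝ} (hB8 : 8 ≤ B) (hMB : 4 * (M : ℝ) < B) (i : ℕ)
    (hi : i < 4 * M + 3) :
    0 < (-1 : ℝ) ^ (i + 1) * gg[B, M]((if i = 4 * M + 1 then 2 * B ^ (14 * M + 9) else
      B ^ (if i = 0 then 9 else if i = 4 * M + 2 then 14 * M + 24 else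
        14 * ((i - 1) / 4) + (if (i - 1) % 4 = 0 then 12 else if (i - 1) % 4 = 1 then 13
          else if (i - 1) % 4 = 2 then 15 else 22)))) := by
  have hB2 : 2 ≤ B := by linarith
  by_cases h0 : i = 0
  · rw [if_neg (by omega), h0, if_pos rfl, zero_add, pow_one]
    have := twoHubSign_first M hB2; linarith
  by_cases hlast : i = 4 * M + 2
  · rw [if_neg (by omega), hlast, if_neg (by omega), if_pos rfl,
      show 4 * M + 2 + 1 = 2 * (2 * M + 1) + 1 by ring, pow_succ, pow_mul, neg_one_sq, one_pow, one_mul]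
    have := twoHubSign_last M hB8 hMB; linarith
  by_cases hfin : i = 4 * M + 1
  · rw [if_pos hfin, hfin, show 4 * M + 1 + 1 = 2 * (2 * M + 1) by ring, pow_mul, neg_one_sq, one_pow, one_mul]
    exact twoHubSign_finalDip hM hB2
  -- leaf readings: `i = 4q + c + 1`, `q < M`, `c < 4`
  obtain ⟨q, c, hqc, hc4⟩ : ∃ q c : ℕ, i = 4 * q + c + 1 ∧ c < 4 :=
    ⟨(i - 1) / 4, (i - 1) % 4, by omega, Nat.mod_lt _ (by norm_num)⟩
  have hqM : q < M := by omega
  set k : Fin M := ⟨q, hqM⟩ with hk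
  have hkv : (k : ℕ) = q := rfl
  rw [if_neg hfin, hqc, if_neg (show ¬ (4 * q + c + 1 = 0) by omega), if_neg (show ¬ (4 * q + c + 1 = 4 * M + 2) by omega),
    show (4 * q + c + 1 - 1) / 4 = q by omega, show (4 * q + c + 1 - 1) % 4 = c by omega]
  interval_cases c
  · rw [if_pos rfl, show 4 * q + 0 + 1 + 1 = 2 * (2 * q + 1) by ring, pow_mul, neg_one_sq, one_pow, one_mul, ← hkv]
    exact twoHubSign_pre (M := M) hB8 k
  · rw [if_neg (by norm_num), if_pos rfl, show 4 * q + 1 + 1 + 1 = 2 * (2 * q + 1) + 1 by ring,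
      pow_succ, pow_mul, neg_one_sq, one_pow, one_mul, ← hkv]
    have := twoHubSign_dip (M := M) hB8 hMB k; linarith
  · rw [if_neg (by norm_num), if_neg (by norm_num), if_pos rfl,
      show 4 * q + 2 + 1 + 1 = 2 * (2 * q + 2) by ring, pow_mul, neg_one_sq, one_pow, one_mul, ← hkv]
    exact twoHubSign_post (M := M) hB8 k
  · rw [if_neg (by norm_num), if_neg (by norm_num), if_neg (by norm_num),
      show 4 * q + 3 + 1 + 1 = 2 * (2 * q + 2) + 1 by ring, pow_succ, pow_mul, neg_one_sq, one_pow, one_mul, ← hkv]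
    have := twoHubSign_bridge (M := M) hB8 hMB k; linarith

/-- The certificate points are positive, increasing, and avoid `B^{11}`. [bookkeeping] -/
theorem twoHub_points {M : ℕ} (hM : 1 ≤ M) {B : ℝ} (hB2 : 2 ≤ B) (i : ℕ) :
    0 < (if i = 4 * M + 1 then 2 * B ^ (14 * M + 9) else
      B ^ (if i = 0 then 9 else if i = 4 * M + 2 then 14 * M + 24 else
        14 * ((i - 1) / 4) + (if (i - 1) % 4 = 0 then 12 else if (i - 1) % 4 = 1 then 13
          else if (i - 1) % 4 = 2 then 15 else 22))) ∧ (if i = 4 * M + 1 then 2 * B ^ (14 * M + 9) else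
      B ^ (if i = 0 then 9 else if i = 4 * M + 2 then 14 * M + 24 else
        14 * ((i - 1) / 4) + (if (i - 1) % 4 = 0 then 12 else if (i - 1) % 4 = 1 then 13
          else if (i - 1) % 4 = 2 then 15 else 22))) ≠ B ^ 11 ∧ (i + 1 < 4 * M + 3 → (if i = 4 * M + 1 then 2 * B ^ (14 * M + 9) else
      B ^ (if i = 0 then 9 else if i = 4 * M + 2 then 14 * M + 24 else
        14 * ((i - 1) / 4) + (if (i - 1) % 4 = 0 then 12 else if (i - 1) % 4 = 1 then 13
          else if (i - 1) % 4 = 2 then 15 else 22))) < (if (i + 1) = 4 * M + 1 then 2 * B ^ (14 * M + 9) else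
      B ^ (if (i + 1) = 0 then 9 else if (i + 1) = 4 * M + 2 then 14 * M + 24 else
        14 * ((i + 1 - 1) / 4) + (if (i + 1 - 1) % 4 = 0 then 12 else if (i + 1 - 1) % 4 = 1 then 13
          else if (i + 1 - 1) % 4 = 2 then 15 else 22)))) := by
  have hB0 : 0 < B := by linarith
  have hB1 : 1 < B := by linarith
  refine ⟨by split_ifs <;> positivity, ?_, fun hi1 => ?_⟩
  · by_cases h : i = 4 * M + 1
    · rw [if_pos h]
      intro h'
      have : B ^ 11 ≤ B ^ (14 * M + 9) := pow_le_pow_right₀ hB1.le (by omega)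
      nlinarith [pow_pos hB0 (14 * M + 9)]
    · rw [if_neg h]
      intro h'
      exact twoHub_exp_ne M i (pow_right_injective₀ hB0 hB1.ne' h')
  · by_cases h1 : i + 1 = 4 * M + 1
    · have h2 : i ≠ 4 * M + 1 := by omega
      rw [if_pos h1, if_neg h2, if_neg (show ¬ (i = 0) by omega), if_neg (show ¬ (i = 4 * M + 2) by omega),
        if_neg (show ¬ ((i - 1) % 4 = 0) by omega), if_neg (show ¬ ((i - 1) % 4 = 1) by omega),
        if_neg (show ¬ ((i - 1) % 4 = 2) by omega)]
      have hle : 14 * ((i - 1) / 4) + 22 ≤ 14 * M + 9 := by omega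
      calc B ^ (14 * ((i - 1) / 4) + 22) ≤ B ^ (14 * M + 9) := pow_le_pow_right₀ hB1.le hle
        _ < 2 * B ^ (14 * M + 9) := by linarith [pow_pos hB0 (14 * M + 9)]
    · by_cases h2 : i = 4 * M + 1
      · have h3 : i + 1 ≠ 4 * M + 1 := by omega
        rw [if_pos h2, if_neg h3, if_neg (show ¬ (i + 1 = 0) by omega), if_pos (show i + 1 = 4 * M + 2 by omega),
          show 14 * M + 24 = 14 * M + 9 + 15 by ring, pow_add B (14 * M + 9) 15]
        have hB15 : B ^ 2 ≤ B ^ 15 := pow_le_pow_right₀ hB1.le (by norm_num)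
        have h4 : (4 : ℝ) ≤ B ^ 2 := by nlinarith
        nlinarith [mul_pos (pow_pos hB0 (14 * M + 9)) (show (0 : ℝ) < B ^ 15 - 2 by linarith)]
      · rw [if_neg h2, if_neg h1]
        exact pow_lt_pow_right₀ hB1 (twoHub_exp_mono M i (by omega))

/-! ## §5 Assembly: the `(0,1,4)` ladder is realisable at every rung `m ≥ 3` -/

/-- **Rung `M + 2` of the `(0,1,4)` ladder: `FullyRealisable (M+2) ![0,1,4] (4M+2)`** (`M ≥ 1` quartic leaves, base
`B = 16(M+1)`), certified at the `4M + 3` points `B⁹`; `B^{14k+12}, B^{14k+13}, B^{14k+15}, B^{14k+22}` (`k < M`);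
`2B^{14M+9}`, `B^{14M+24}`, where `(-1)^{i+1} g > 0`. [folklore] -/
theorem fullyRealisable_ladder014_succ (M : ℕ) (hM : 1 ≤ M) :
    FullyRealisable (M + 1 + 1) (![0, 1, 4] : Fin 3 → ℕ) (4 * M + 2) := by
  -- the base
  set B : ℝ := 16 * ((M : ℝ) + 1) with hBdef
  have hM0 : (0 : ℝ) ≤ M := Nat.cast_nonneg M
  have hB8 : 8 ≤ B := by rw [hBdef]; linarith
  have hMB : 4 * (M : ℝ) < B := by rw [hBdef]; linarith
  obtain ⟨hB0, hB1, hB2⟩ : 0 < B ∧ 1 < B ∧ 2 ≤ B := ⟨by linarith, by linarith, by linarith⟩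
  -- coefficient vectors of the letters (leaf `0` = the affine node)
  set β : Fin (M + 1) → ℝ := Matrix.vecCons (-(1 / B ^ 11)) (fun _ : Fin M => (0 : ℝ)) with hβ
  set τv : Fin (M + 1) → ℝ := Matrix.vecCons (0 : ℝ) (fun k : Fin M => 1 / B ^ (56 * ((k : ℕ) + 1))) with hτv
  set b₀ : Fin (M + 1) → ℝ := Matrix.vecCons (0 : ℝ) (fun k : Fin M => B / B ^ (7 * (k : ℕ))) with hb₀
  set b₁ : Fin (M + 1) → ℝ :=
    Matrix.vecCons (1 / B ^ 11 - 1 / (2 * B ^ (14 * M + 9))) (fun k : Fin M => -(1 / B ^ (21 * (k : ℕ) + 12))) with hb₁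
  -- the letters
  set S : Fin 3 → Matrix (Fin (M + 1 + 1)) (Fin (M + 1 + 1)) ℝ :=
    ![Matrix.reindex finSumFinEquiv finSumFinEquiv
        (Matrix.fromBlocks (diagonal fun _ : Fin (M + 1) => (1 : ℝ))
          (Matrix.of fun (i : Fin (M + 1)) (_ : Fin 1) => b₀ i)
          (Matrix.of fun (_ : Fin 1) (i : Fin (M + 1)) => b₀ i)
          (Matrix.of fun (_ _ : Fin 1) => (-1 : ℝ))),
      Matrix.reindex finSumFinEquiv finSumFinEquiv
        (Matrix.fromBlocks (diagonal β)
          (Matrix.of fun (i : Fin (M + 1)) (_ : Fin 1) => b₁ i)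
          (Matrix.of fun (_ : Fin 1) (i : Fin (M + 1)) => b₁ i)
          (Matrix.of fun (_ _ : Fin 1) => 1 / B ^ (14 * M + 9) - 1 / B ^ 11)),
      Matrix.reindex finSumFinEquiv finSumFinEquiv
        (Matrix.fromBlocks (diagonal τv)
          (Matrix.of fun (_ : Fin (M + 1)) (_ : Fin 1) => (0 : ℝ))
          (Matrix.of fun (_ : Fin 1) (_ : Fin (M + 1)) => (0 : ℝ))
          (Matrix.of fun (_ _ : Fin 1) => (0 : ℝ)))] with hSdef
  -- the determinant polynomial
  set p : ℝ[X] :=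
    (C (-1 : ℝ) + C (1 / B ^ (14 * M + 9) - 1 / B ^ 11) * X) * ∏ i : Fin (M + 1), (C 1 + C (β i) * X + C (τv i) * X ^ 4)
      - ∑ i : Fin (M + 1), (C (b₀ i) + C (b₁ i) * X) ^ 2 *
          ∏ j ∈ univ.erase i, (C 1 + C (β j) * X + C (τv j) * X ^ 4) with hpdef
  -- evaluated pencil = arrowhead matrix
  have hA : ∀ t : ℝ, (∑ l, t ^ (![0, 1, 4] : Fin 3 → ℕ) l • S l)
      = Matrix.reindex finSumFinEquiv finSumFinEquiv
          (Matrix.fromBlocks (diagonal fun i : Fin (M + 1) => 1 + β i * t + τv i * t ^ 4)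
            (Matrix.of fun (i : Fin (M + 1)) (_ : Fin 1) => b₀ i + b₁ i * t)
            (Matrix.of fun (_ : Fin 1) (i : Fin (M + 1)) => b₀ i + b₁ i * t)
            (Matrix.of fun (_ _ : Fin 1) => -1 + (1 / B ^ (14 * M + 9) - 1 / B ^ 11) * t)) := by
    intro t
    rw [hSdef, hβ, hτv, hb₀, hb₁]
    exact twoHubPencil_eval M B t
  -- the leaf diagonal entries vanish only at `t = B^{11}` (leaf `0`)
  have ha_ne : ∀ t : ℝ, t ≠ B ^ 11 → ∀ i : Fin (M + 1), 1 + β i * t + τv i * t ^ 4 ≠ 0 := by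
    intro t ht
    refine Fin.cases ?_ (fun k => ?_)
    · simp only [hβ, hτv, Matrix.cons_val_zero, zero_mul, add_zero]
      intro h
      apply ht
      field_simp at h
      linarith
    · simp only [hβ, hτv, Matrix.cons_val_succ, zero_mul, add_zero]
      have : 0 ≤ 1 / B ^ (56 * ((k : ℕ) + 1)) * t ^ 4 := by positivity
      linarith
  have hevalp : ∀ t : ℝ, t ≠ B ^ 11 → (∑ l, t ^ (![0, 1, 4] : Fin 3 → ℕ) l • S l).det = p.eval t := by
    intro t ht
    rw [hA, Matrix.det_reindex_self, det_arrow _ _ _ (ha_ne t ht), arrow_prod_mul_schur _ _ _ (ha_ne t ht), hpdef,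
      eval_twoHubPoly]
  -- hence a polynomial identity, valid at every real `t`
  have hpoly : (pencil (![0, 1, 4] : Fin 3 → ℕ) S).det = p := by
    apply Polynomial.eq_of_infinite_eval_eq
    refine Set.Infinite.mono (fun t (ht : t ∈ Set.Ioi (B ^ 11)) => ?_) (Set.Ioi_infinite (B ^ 11))
    show ((pencil (![0, 1, 4] : Fin 3 → ℕ) S).det).eval t = p.eval t
    rw [eval_det_pencil, hevalp t (ne_of_gt ht)]
  have heval : ∀ t : ℝ, (∑ l, t ^ (![0, 1, 4] : Fin 3 → ℕ) l • S l).det = p.eval t := by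
    intro t
    rw [← eval_det_pencil S (![0, 1, 4] : Fin 3 → ℕ) t]
    exact congrArg (Polynomial.eval t) hpoly
  have hdeg : p.natDegree ≤ 4 * M + 2 := by
    rw [hpdef, hβ, hτv]
    exact natDegree_twoHubPoly_le M (-1) _ _ _ b₀ b₁
  -- the determinant at `t ≥ 0`, `t ≠ B^{11}`: (positive leaf product) × g(t)
  have hvecA : ∀ t : ℝ, (fun i : Fin (M + 1) => 1 + β i * t + τv i * t ^ 4)
      = Matrix.vecCons (1 + -(1 / B ^ 11) * t) (fun k : Fin M => 1 + 1 / B ^ (56 * ((k : ℕ) + 1)) * t ^ 4) := by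
    intro t; funext i; refine Fin.cases ?_ (fun k => ?_) i
    · simp [hβ, hτv]
    · simp [hβ, hτv]
  have hvecB : ∀ t : ℝ, (fun i : Fin (M + 1) => b₀ i + b₁ i * t)
      = Matrix.vecCons ((1 / B ^ 11 - 1 / (2 * B ^ (14 * M + 9))) * t)
          (fun k : Fin M => B / B ^ (7 * (k : ℕ)) + -(1 / B ^ (21 * (k : ℕ) + 12)) * t) := by
    intro t; funext i; refine Fin.cases ?_ (fun k => ?_) i
    · simp [hb₀, hb₁]
    · simp [hb₀, hb₁]
  have hg : ∀ t : ℝ, 0 ≤ t → t ≠ B ^ 11 → (∑ l, t ^ (![0, 1, 4] : Fin 3 → ℕ) l • S l).det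
      = (∏ k : Fin M, (1 + 1 / B ^ (56 * ((k : ℕ) + 1)) * t ^ 4)) * gg[B, M](t) := by
    intro t ht0 ht
    rw [hA, Matrix.det_reindex_self, det_arrow _ _ _ (ha_ne t ht)]
    rw [show (∏ i : Fin (M + 1), (1 + β i * t + τv i * t ^ 4))
          = ∏ i, Matrix.vecCons (1 + -(1 / B ^ 11) * t) (fun k : Fin M => 1 + 1 / B ^ (56 * ((k : ℕ) + 1)) * t ^ 4) i
        from by rw [← hvecA t],
      show (∑ i : Fin (M + 1), (b₀ i + b₁ i * t) ^ 2 / (1 + β i * t + τv i * t ^ 4))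
          = ∑ i, Matrix.vecCons ((1 / B ^ 11 - 1 / (2 * B ^ (14 * M + 9))) * t)
              (fun k : Fin M => B / B ^ (7 * (k : ℕ)) + -(1 / B ^ (21 * (k : ℕ) + 12)) * t) i ^ 2
            / Matrix.vecCons (1 + -(1 / B ^ 11) * t) (fun k : Fin M => 1 + 1 / B ^ (56 * ((k : ℕ) + 1)) * t ^ 4) i
        from by rw [← hvecA t, ← hvecB t]]
    have ha0 : 1 + -(1 / B ^ 11) * t ≠ 0 := by
      have := ha_ne t ht 0
      simpa [hβ, hτv] using this
    rw [twoHub_schur_split _ _ _ _ _ ha0]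
    congr 1
    have hsq : (1 + -(1 / B ^ 11) * t) * (-1 + (1 / B ^ (14 * M + 9) - 1 / B ^ 11) * t)
        - ((1 / B ^ 11 - 1 / (2 * B ^ (14 * M + 9))) * t) ^ 2 = -(1 - t / (2 * B ^ (14 * M + 9))) ^ 2 := by
      field_simp
      ring
    have hterm : ∀ k : Fin M, (B / B ^ (7 * (k : ℕ)) + -(1 / B ^ (21 * (k : ℕ) + 12)) * t) ^ 2
        / (1 + 1 / B ^ (56 * ((k : ℕ) + 1)) * t ^ 4) = H[B, k](t) := by
      intro k
      rw [show B / B ^ (7 * (k : ℕ)) + -(1 / B ^ (21 * (k : ℕ) + 12)) * t = B / B ^ (7 * (k : ℕ)) - t / B ^ (21 * (k : ℕ) + 12)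
            by ring,
        show 1 + 1 / B ^ (56 * ((k : ℕ) + 1)) * t ^ 4 = 1 + t ^ 4 / B ^ (56 * ((k : ℕ) + 1)) by ring]
    rw [Finset.sum_congr rfl fun k _ => hterm k, hsq]
    have hw : -((1 + -(1 / B ^ 11) * t)) = t / B ^ 11 - 1 := by ring
    rw [← hw]
    ring
  -- the certificate points `τ_i = B^{e_i}` (`i ≠ 4M+1`), `τ_{4M+1} = 2 B^{14M+9}` (the hub's dip)
  set τ : Fin (4 * M + 3) → ℝ := fun i =>
    if (i : ℕ) = 4 * M + 1 then 2 * B ^ (14 * M + 9) else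
      B ^ (if (i : ℕ) = 0 then 9 else if (i : ℕ) = 4 * M + 2 then 14 * M + 24 else
        14 * (((i : ℕ) - 1) / 4) + (if ((i : ℕ) - 1) % 4 = 0 then 12 else if ((i : ℕ) - 1) % 4 = 1 then 13
          else if ((i : ℕ) - 1) % 4 = 2 then 15 else 22)) with hτdef
  have hτpos : ∀ i, 0 < τ i := fun i => (twoHub_points hM hB2 (i : ℕ)).1
  have hτne : ∀ i, τ i ≠ B ^ 11 := fun i => (twoHub_points hM hB2 (i : ℕ)).2.1
  have hτmono : StrictMono τ := by
    refine Fin.strictMono_iff_lt_succ.2 fun i => ?_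
    have hi := i.isLt
    have h := (twoHub_points hM hB2 (i : ℕ)).2.2 (by omega)
    rw [hτdef]
    dsimp only
    simp only [Fin.val_castSucc, Fin.val_succ]
    exact h
  have hsign : ∀ i : Fin (4 * M + 3), 0 < (-1 : ℝ) ^ ((i : ℕ) + 1) * gg[B, M](τ i) := fun i =>
    twoHub_sign_table hM hB8 hMB (i : ℕ) i.isLt
  -- conclude with the certificate
  have hPP : ∀ s t : ℝ, 0 < (∏ k : Fin M, (1 + 1 / B ^ (56 * ((k : ℕ) + 1)) * s ^ 4)) *
      (∏ k : Fin M, (1 + 1 / B ^ (56 * ((k : ℕ) + 1)) * t ^ 4)) := fun s t =>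
    mul_pos (Finset.prod_pos fun k _ => by positivity) (Finset.prod_pos fun k _ => by positivity)
  refine fullyRealisable_of_certificate _ S (fun l => by rw [hSdef, hβ, hτv, hb₀, hb₁]; exact twoHubPencil_isSymm M B l)
    p heval hdeg τ hτmono hτpos fun i => ?_
  rw [hg _ (hτpos _).le (hτne _), hg _ (hτpos _).le (hτne _)]
  have h1 := hsign i.castSucc
  have h2 := hsign i.succ
  simp only [Fin.val_castSucc] at h1
  simp only [Fin.val_succ] at h2
  rw [pow_succ] at h2
  set s : ℝ := (-1 : ℝ) ^ ((i : ℕ) + 1) with hs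
  have hss : s * s = 1 := by rw [hs, ← pow_add, ← two_mul, pow_mul]; norm_num
  set G1 := gg[B, M](τ i.castSucc) with hG1
  set G2 := gg[B, M](τ i.succ) with hG2
  have h12 := mul_pos h1 h2
  have hre : s * G1 * (s * -1 * G2) = -(s * s) * (G1 * G2) := by ring
  rw [hre, hss] at h12
  have hneg : G1 * G2 < 0 := by linarith
  have hpos := hPP (τ i.castSucc) (τ i.succ)
  set P1 := ∏ k : Fin M, (1 + 1 / B ^ (56 * ((k : ℕ) + 1)) * τ i.castSucc ^ 4) with hP1
  set P2 := ∏ k : Fin M, (1 + 1 / B ^ (56 * ((k : ℕ) + 1)) * τ i.succ ^ 4) with hP2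
  calc P1 * G1 * (P2 * G2) = (P1 * P2) * (G1 * G2) := by ring
    _ < 0 := mul_neg_of_pos_of_neg hpos hneg

/-- **THE `(0,1,4)` LADDER IS REALISABLE AT EVERY RUNG: `FullyRealisable m ![0,1,4] (4m − 6)` for all `m ≥ 3`** — this
includes the column's TOP values `ν(4,3) = 10`, `ν(5,3) = 14`, `ν(6,3) = 18` (`= n(m,2)`) as instances of ONE all-`m` design,
and for `m ≥ 7` the rung below the top. [folklore] -/
theorem fullyRealisable_ladder014 (m : ℕ) (hm : 3 ≤ m) : FullyRealisable m (![0, 1, 4] : Fin 3 → ℕ) (4 * m - 6) := by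
  obtain ⟨M, rfl⟩ : ∃ M, m = M + 1 + 1 := ⟨m - 2, by omega⟩
  rw [show 4 * (M + 1 + 1) - 6 = 4 * M + 2 by omega]
  exact fullyRealisable_ladder014_succ M (by omega)

/-! ## §6 Stamp-table readings: `ν(m,3) ≥ 4m − 6` and `η(m,3) ≥ 8m − 12` for every `m ≥ 3` -/

/-- **`ν(m,3) ≥ 4m − 6` for every `m ≥ 3`** (kernel, all sizes): `¬ StampLawAt m 3 (4m − 7)`.  Supersedes `3m − 2`
(`not_stampLawAt_ladder013`) for `m ≥ 5`; EXACT at `m = 4, 5, 6` by `stampLawAt_K_three` (`n(m,2) = 10, 14, 18`). [folklore] -/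
theorem not_stampLawAt_ladder014 (m : ℕ) (hm : 3 ≤ m) : ¬ StampLawAt m 3 (4 * m - 7) := by
  intro h
  obtain ⟨S, hS, hfull, hdeg⟩ := fullyRealisable_ladder014 m hm
  have := h _ S hS hfull
  omega

/-- **`η(m,3) ≥ 8m − 12` for every `m ≥ 3`**: `¬ HypRootLawAt m 3 (8m − 13)` (doubling, `not_hypRootLawAt_of_fullyRealisable`).
[folklore] -/
theorem not_hypRootLawAt_ladder014 (m : ℕ) (hm : 3 ≤ m) : ¬ HypRootLawAt m 3 (8 * m - 13) :=
  not_hypRootLawAt_of_fullyRealisable (fullyRealisable_ladder014 m hm) (by omega)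

/-- **The top of the `K = 3` stamp column at `m = 4, 5, 6` from ONE all-`m` family**: `FullyRealisable 4 ![0,1,4] 10`,
`FullyRealisable 5 ![0,1,4] 14`, `FullyRealisable 6 ![0,1,4] 18` (= `n(m,2)`; the tree's witnesses for these rows were found by
numerical search). [folklore] -/
theorem fullyRealisable_ladder014_top :
    FullyRealisable 4 (![0, 1, 4] : Fin 3 → ℕ) 10 ∧ FullyRealisable 5 (![0, 1, 4] : Fin 3 → ℕ) 14 ∧
      FullyRealisable 6 (![0, 1, 4] : Fin 3 → ℕ) 18 :=
  ⟨fullyRealisable_ladder014 4 (by norm_num), fullyRealisable_ladder014 5 (by norm_num),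
    fullyRealisable_ladder014 6 (by norm_num)⟩


/-- **THE `(0,1,4)` COLUMN IS EXACT (kernel, all `m ≥ 3`)**: `4m − 6` is realised (`fullyRealisable_ladder014`) and is the
ceiling of the support (`natDegree_le_ladder` of `…FiniteSectorLadderCeiling` at `d = 4`). [folklore] -/
theorem ladder014_exact (m : ℕ) (hm : 3 ≤ m) :
    FullyRealisable m (![0, 1, 4] : Fin 3 → ℕ) (4 * m - 6) ∧
      ∀ S : Fin 3 → Matrix (Fin m) (Fin m) ℝ, IsFullPosRooted (pencil (![0, 1, 4] : Fin 3 → ℕ) S).det →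
        (pencil (![0, 1, 4] : Fin 3 → ℕ) S).det.natDegree ≤ 4 * m - 6 := by
  refine ⟨fullyRealisable_ladder014 m hm, fun S hS => ?_⟩
  have h := natDegree_le_ladder (by omega) 4 (by norm_num) (by omega) S hS
  have : 4 * (m + 3 - 4) - 2 = 4 * m - 6 := by omega
  omega

end Summit.ValiantsHypothesis.ValiantsHypothesis.Theorems.LacunarySymmetroidMatrixDescartes.FiniteSector
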